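import Summits.ResolutionOfSingularities.ResolutionOfSingularities.Theorems.HomologicalConductorNoZenoNoetherianCapture
import Summits.ResolutionOfSingularities.ResolutionOfSingularities.Theorems.HomologicalConductorNoZenoTraceSocleTerminator
import Literature.AlgebraicGeometry.Resolution.QuasiExcellentSchemes
import Literature.AlgebraicGeometry.Morphisms.CechH2FibreDimOne
import Literature.AlgebraicGeometry.Resolution.Lipman1969RationalSurfaceSingularities
import Literature.AlgebraicGeometry.Resolution.Lipman1969FormallySmoothBaseChange
import Literature.AlgebraicGeometry.Resolution.Lipman1969RationalContraction
import HarnessLib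

/-!
# Crux `NoZenoR` (stmt-ResolutionOfSingularities-19943), slot 2 `stub_beta1RankOneSharpF`: the REGISTRY-LEVEL RE-CUT of β1ʳ¹♯ —
# the registered slot text ⟺ its EXHAUSTIVE branch ∧ NOETHERIAN CAPTURE on branch (b) (idea-1 card 12 `generic-fibre-ladder`)

OURS (cell res-hironaka, crux chain W4.4; source: res-L0-w44-idea-1 `Sketch-idea-1-r13.lean` 1301e7a2059ff799 §r13.3 :339–:436, sorry-free there;
THM NC `NoetherianCapture.terminates_of_noetherianCapture` already in the tree; tree port by the lead res-L0-w44-lead-1 g9, DESK WORD 38 OBJECT 2-Q).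
AI-written, weaker than expert review; nothing here is a statement of the manuscript under review (Hironaka 2017).  SUPPORT-level, counted 0.
DEF-FREE: the residual texts `Beta1SharpExhaustive` (branch (a): the tower exhausts `O`) and `Beta1SharpCapture` (branch (b): an unreachable
residually transcendental `t ∈ O`; conclusion = SOME noetherian `k`-subalgebra `N ⊆ O` contains the cohomology annihilators `ca(T_m)` of all
late stages — «bounded capture index», cf. the tree's `terminates_iff_boundedCaptureIndex`) and the registered v28–v33 text
`Cruxes.NoZeno.Lines.Coarsening.Sig.stub_beta1RankOneSharp` are written out VERBATIM as binder / conclusion texts.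

* `beta1RankOneSharp_of_capture : <Exh> → <Cap> → <slot text>` — branch (a) is the exhaustive residual; on branch (b) noetherian capture
  terminates the tower (THM NC).  No `Confined` case split and NO transfer conjecture (`ShannonTransferSharp`) is needed: compare the
  alternative three-text cut `ConfinedSurface.beta1RankOneSharpF_of_residuals` (p582948).
* `beta1SharpCapture_of_sharp`, `beta1SharpExhaustive_of_sharp` — the converses (a regular stage is a noetherian subring of `O` capturing every
  later conductor, the tower being stationary after it): the re-cut loses nothing, slot 2 ⟺ Exh ∧ Cap (kernel).
* `beta1RankOneSharpF_of_capture : <Exh> → <Cap> → <Sig.FactsW unfolded> → <slot text>` — the registered type of `stub_beta1RankOneSharpF`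
  (facts prefix unused).  OUTCOME OF RECORD (desk): slot-2 residual = `Beta1SharpExhaustive ∧ Beta1SharpCapture`, two texts, no conjecture input.
-/

noncomputable section

-- single-problem summit: the doubled namespace component `ResolutionOfSingularities` is forced
set_option linter.dupNamespace false

namespace Summit.ResolutionOfSingularities.ResolutionOfSingularities.Theorems.NoZeno.Beta1Capture

open Summit.ResolutionOfSingularities.ResolutionOfSingularities.Theses.HomologicalConductor
open Summit.ResolutionOfSingularities.ResolutionOfSingularities.Theorems.NoZeno.Birth
open Summit.ResolutionOfSingularities.ResolutionOfSingularities.Theorems.NoZeno.SandwichCluster.Parasite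
open Summit.ResolutionOfSingularities.ResolutionOfSingularities.Theorems
open Summit.ResolutionOfSingularities.ResolutionOfSingularities.Theorems.NoZeno
open Summit.ResolutionOfSingularities.ResolutionOfSingularities.Theorems.NoZeno.NoetherianCapture
  (terminates_of_noetherianCapture_subalgebra tower_eq_of_le_of_isRegularLocalRing)
open Summit.ResolutionOfSingularities.ResolutionOfSingularities.Theorems.NoZeno.TraceSocle (stage_le)
open Literature.AlgebraicGeometry.Resolution
open IsLocalRing Polynomial

variable {k K : Type} [Field k] [Field K] [Algebra k K]

/-- **REGISTRY-LEVEL RE-CUT OF β1ʳ¹♯ (PROVED).**  The registered rank-one slot text (conclusion) follows from its exhaustive branch (`h₂` =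
`Beta1SharpExhaustive`) and NOETHERIAN CAPTURE on branch (b) (`h₃` = `Beta1SharpCapture`); no `Confined` case split and no transfer conjecture is
needed. [this work] -/
theorem beta1RankOneSharp_of_capture
    (h₂ :
      PersistenceRadical → StrictDrop → ∀ p : ℕ, p.Prime → ∀ (k K : Type) [Field k] [CharP k p] [Field K]
        [Algebra k K] (O : ValuationSubring K) (A : Subalgebra k K), (∀ c : k, algebraMap k K c ∈ O) →
        A.FG → IsFractionRing ↥A K → A.toSubring ≤ O.toSubring →
        (∀ O' : ValuationSubring K,
          (∀ m : ℕ, ∀ s ∈ tower O A m, s ∈ O' ∧ (s⁻¹ ∈ O' → s⁻¹ ∈ O)) → ¬ IsNoetherianRing ↥O') →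
        (∀ O' : ValuationSubring K, O < O' → ∃ m : ℕ, ∃ s ∈ tower O A m, s⁻¹ ∈ O' ∧ s⁻¹ ∉ O) →
        (∀ (k' K' : Type) [Field k'] [CharP k' p] [Field K'] [Algebra k' K'] (O' : ValuationSubring K')
          (A' : Subalgebra k' K'), (∀ c : k', algebraMap k' K' c ∈ O') → A'.FG → IsFractionRing ↥A' K' →
          A'.toSubring ≤ O'.toSubring → Algebra.trdeg k' K' < Algebra.trdeg k K →
          ∃ m : ℕ, IsRegularLocalRing ↥(tower O' A' m)) →
        (∀ m : ℕ, ∀ s ∈ tower O A m, ∃ f : Polynomial k, f ≠ 0 ∧ O.valuation (Polynomial.aeval s f) < 1) →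
        3 ≤ Algebra.trdeg k K →
        (∀ O₁ : ValuationSubring K, O < O₁ → O₁ = ⊤) →
        (∀ x : K, x ∈ O → ∃ m : ℕ, x ∈ tower O A m) →
        ¬ SingularPrimeThread O A →
        ∃ m : ℕ, IsRegularLocalRing ↥(tower O A m))
    (h₃ :
      PersistenceRadical → StrictDrop → ∀ p : ℕ, p.Prime → ∀ (k K : Type) [Field k] [CharP k p] [Field K]
        [Algebra k K] (O : ValuationSubring K) (A : Subalgebra k K), (∀ c : k, algebraMap k K c ∈ O) →
        A.FG → IsFractionRing ↥A K → A.toSubring ≤ O.toSubring →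
        (∀ O' : ValuationSubring K,
          (∀ m : ℕ, ∀ s ∈ tower O A m, s ∈ O' ∧ (s⁻¹ ∈ O' → s⁻¹ ∈ O)) → ¬ IsNoetherianRing ↥O') →
        (∀ O' : ValuationSubring K, O < O' → ∃ m : ℕ, ∃ s ∈ tower O A m, s⁻¹ ∈ O' ∧ s⁻¹ ∉ O) →
        (∀ (k' K' : Type) [Field k'] [CharP k' p] [Field K'] [Algebra k' K'] (O' : ValuationSubring K')
          (A' : Subalgebra k' K'), (∀ c : k', algebraMap k' K' c ∈ O') → A'.FG → IsFractionRing ↥A' K' →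
          A'.toSubring ≤ O'.toSubring → Algebra.trdeg k' K' < Algebra.trdeg k K →
          ∃ m : ℕ, IsRegularLocalRing ↥(tower O' A' m)) →
        (∀ m : ℕ, ∀ s ∈ tower O A m, ∃ f : Polynomial k, f ≠ 0 ∧ O.valuation (Polynomial.aeval s f) < 1) →
        3 ≤ Algebra.trdeg k K →
        (∀ O₁ : ValuationSubring K, O < O₁ → O₁ = ⊤) →
        (∃ t : K, t ∈ O ∧ (∀ m : ℕ, t ∉ tower O A m) ∧
          ∀ f : Polynomial k, f ≠ 0 → ¬ O.valuation (Polynomial.aeval t f) < 1) →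
        ¬ SingularPrimeThread O A →
        ∃ (N : Subalgebra k K) (m₀ : ℕ), IsNoetherianRing ↥N ∧ N.toSubring ≤ O.toSubring ∧
          ∀ m : ℕ, m₀ ≤ m → ∀ x ∈ ca (tower O A m), x ∈ N) :
    PersistenceRadical → StrictDrop → ∀ p : ℕ, p.Prime → ∀ (k K : Type) [Field k] [CharP k p] [Field K]
      [Algebra k K] (O : ValuationSubring K) (A : Subalgebra k K), (∀ c : k, algebraMap k K c ∈ O) →
      A.FG → IsFractionRing ↥A K → A.toSubring ≤ O.toSubring →
      (∀ O' : ValuationSubring K,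
        (∀ m : ℕ, ∀ s ∈ tower O A m, s ∈ O' ∧ (s⁻¹ ∈ O' → s⁻¹ ∈ O)) → ¬ IsNoetherianRing ↥O') →
      (∀ O' : ValuationSubring K, O < O' → ∃ m : ℕ, ∃ s ∈ tower O A m, s⁻¹ ∈ O' ∧ s⁻¹ ∉ O) →
      (∀ (k' K' : Type) [Field k'] [CharP k' p] [Field K'] [Algebra k' K'] (O' : ValuationSubring K')
        (A' : Subalgebra k' K'), (∀ c : k', algebraMap k' K' c ∈ O') → A'.FG → IsFractionRing ↥A' K' →
        A'.toSubring ≤ O'.toSubring → Algebra.trdeg k' K' < Algebra.trdeg k K →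
        ∃ m : ℕ, IsRegularLocalRing ↥(tower O' A' m)) →
      (∀ m : ℕ, ∀ s ∈ tower O A m, ∃ f : Polynomial k, f ≠ 0 ∧ O.valuation (Polynomial.aeval s f) < 1) →
      3 ≤ Algebra.trdeg k K →
      (∀ O₁ : ValuationSubring K, O < O₁ → O₁ = ⊤) →
      ((∀ x : K, x ∈ O → ∃ m : ℕ, x ∈ tower O A m) ∨
        (∃ t : K, t ∈ O ∧ (∀ m : ℕ, t ∉ tower O A m) ∧
          ∀ f : Polynomial k, f ≠ 0 → ¬ O.valuation (Polynomial.aeval t f) < 1)) →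
      ¬ SingularPrimeThread O A →
      ∃ m : ℕ, IsRegularLocalRing ↥(tower O A m) := by
  intro hP hD p hp k K _ _ _ _ O A hk hA hfr hAO hker hmax IH hzd htr hr1 hNF hthr
  rcases hNF with hexh | hb
  · exact h₂ hP hD p hp k K O A hk hA hfr hAO hker hmax IH hzd htr hr1 hexh hthr
  · obtain ⟨N, m₀, hN, hNO, hcap⟩ := h₃ hP hD p hp k K O A hk hA hfr hAO hker hmax IH hzd htr hr1 hb hthr
    exact terminates_of_noetherianCapture_subalgebra hD p hp k K O A hk hA hfr hAO N hN hNO m₀ hcap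

/-- **Conversely, `Beta1SharpCapture` is a special case of β1ʳ¹♯** (`h` = the registered slot text): the regular stage is a noetherian subring
of `O` capturing every later conductor (the tower is stationary after it, `NoetherianCapture.tower_eq_of_le_of_isRegularLocalRing`).  So the
re-cut loses nothing. [this work] -/
theorem beta1SharpCapture_of_sharp
    (h :
      PersistenceRadical → StrictDrop → ∀ p : ℕ, p.Prime → ∀ (k K : Type) [Field k] [CharP k p] [Field K]
        [Algebra k K] (O : ValuationSubring K) (A : Subalgebra k K), (∀ c : k, algebraMap k K c ∈ O) →
        A.FG → IsFractionRing ↥A K → A.toSubring ≤ O.toSubring →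
        (∀ O' : ValuationSubring K,
          (∀ m : ℕ, ∀ s ∈ tower O A m, s ∈ O' ∧ (s⁻¹ ∈ O' → s⁻¹ ∈ O)) → ¬ IsNoetherianRing ↥O') →
        (∀ O' : ValuationSubring K, O < O' → ∃ m : ℕ, ∃ s ∈ tower O A m, s⁻¹ ∈ O' ∧ s⁻¹ ∉ O) →
        (∀ (k' K' : Type) [Field k'] [CharP k' p] [Field K'] [Algebra k' K'] (O' : ValuationSubring K')
          (A' : Subalgebra k' K'), (∀ c : k', algebraMap k' K' c ∈ O') → A'.FG → IsFractionRing ↥A' K' →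
          A'.toSubring ≤ O'.toSubring → Algebra.trdeg k' K' < Algebra.trdeg k K →
          ∃ m : ℕ, IsRegularLocalRing ↥(tower O' A' m)) →
        (∀ m : ℕ, ∀ s ∈ tower O A m, ∃ f : Polynomial k, f ≠ 0 ∧ O.valuation (Polynomial.aeval s f) < 1) →
        3 ≤ Algebra.trdeg k K →
        (∀ O₁ : ValuationSubring K, O < O₁ → O₁ = ⊤) →
        ((∀ x : K, x ∈ O → ∃ m : ℕ, x ∈ tower O A m) ∨
          (∃ t : K, t ∈ O ∧ (∀ m : ℕ, t ∉ tower O A m) ∧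
            ∀ f : Polynomial k, f ≠ 0 → ¬ O.valuation (Polynomial.aeval t f) < 1)) →
        ¬ SingularPrimeThread O A →
        ∃ m : ℕ, IsRegularLocalRing ↥(tower O A m)) :
    PersistenceRadical → StrictDrop → ∀ p : ℕ, p.Prime → ∀ (k K : Type) [Field k] [CharP k p] [Field K]
      [Algebra k K] (O : ValuationSubring K) (A : Subalgebra k K), (∀ c : k, algebraMap k K c ∈ O) →
      A.FG → IsFractionRing ↥A K → A.toSubring ≤ O.toSubring →
      (∀ O' : ValuationSubring K,
        (∀ m : ℕ, ∀ s ∈ tower O A m, s ∈ O' ∧ (s⁻¹ ∈ O' → s⁻¹ ∈ O)) → ¬ IsNoetherianRing ↥O') →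
      (∀ O' : ValuationSubring K, O < O' → ∃ m : ℕ, ∃ s ∈ tower O A m, s⁻¹ ∈ O' ∧ s⁻¹ ∉ O) →
      (∀ (k' K' : Type) [Field k'] [CharP k' p] [Field K'] [Algebra k' K'] (O' : ValuationSubring K')
        (A' : Subalgebra k' K'), (∀ c : k', algebraMap k' K' c ∈ O') → A'.FG → IsFractionRing ↥A' K' →
        A'.toSubring ≤ O'.toSubring → Algebra.trdeg k' K' < Algebra.trdeg k K →
        ∃ m : ℕ, IsRegularLocalRing ↥(tower O' A' m)) →
      (∀ m : ℕ, ∀ s ∈ tower O A m, ∃ f : Polynomial k, f ≠ 0 ∧ O.valuation (Polynomial.aeval s f) < 1) →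
      3 ≤ Algebra.trdeg k K →
      (∀ O₁ : ValuationSubring K, O < O₁ → O₁ = ⊤) →
      (∃ t : K, t ∈ O ∧ (∀ m : ℕ, t ∉ tower O A m) ∧
        ∀ f : Polynomial k, f ≠ 0 → ¬ O.valuation (Polynomial.aeval t f) < 1) →
      ¬ SingularPrimeThread O A →
      ∃ (N : Subalgebra k K) (m₀ : ℕ), IsNoetherianRing ↥N ∧ N.toSubring ≤ O.toSubring ∧
        ∀ m : ℕ, m₀ ≤ m → ∀ x ∈ ca (tower O A m), x ∈ N := by
  intro hP hD p hp k K _ _ _ _ O A hk hA hfr hAO hker hmax IH hzd htr hr1 hb hthr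
  obtain ⟨m, hm⟩ := h hP hD p hp k K O A hk hA hfr hAO hker hmax IH hzd htr hr1 (Or.inr hb) hthr
  refine ⟨tower O A m, m, stub_towerNoetherian k K O A hk hA hfr hAO m,
    fun x hx => stage_le O A hk hAO m x hx, fun m' hm' x hx => ?_⟩
  rw [tower_eq_of_le_of_isRegularLocalRing O A hk hfr hAO m hm m' hm'] at hx
  exact ca_subset _ hx

/-- **The exhaustive residual is likewise a special case of β1ʳ¹♯** (`h` = the registered slot text). [this work] -/
theorem beta1SharpExhaustive_of_sharp
    (h :
      PersistenceRadical → StrictDrop → ∀ p : ℕ, p.Prime → ∀ (k K : Type) [Field k] [CharP k p] [Field K]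
        [Algebra k K] (O : ValuationSubring K) (A : Subalgebra k K), (∀ c : k, algebraMap k K c ∈ O) →
        A.FG → IsFractionRing ↥A K → A.toSubring ≤ O.toSubring →
        (∀ O' : ValuationSubring K,
          (∀ m : ℕ, ∀ s ∈ tower O A m, s ∈ O' ∧ (s⁻¹ ∈ O' → s⁻¹ ∈ O)) → ¬ IsNoetherianRing ↥O') →
        (∀ O' : ValuationSubring K, O < O' → ∃ m : ℕ, ∃ s ∈ tower O A m, s⁻¹ ∈ O' ∧ s⁻¹ ∉ O) →
        (∀ (k' K' : Type) [Field k'] [CharP k' p] [Field K'] [Algebra k' K'] (O' : ValuationSubring K')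
          (A' : Subalgebra k' K'), (∀ c : k', algebraMap k' K' c ∈ O') → A'.FG → IsFractionRing ↥A' K' →
          A'.toSubring ≤ O'.toSubring → Algebra.trdeg k' K' < Algebra.trdeg k K →
          ∃ m : ℕ, IsRegularLocalRing ↥(tower O' A' m)) →
        (∀ m : ℕ, ∀ s ∈ tower O A m, ∃ f : Polynomial k, f ≠ 0 ∧ O.valuation (Polynomial.aeval s f) < 1) →
        3 ≤ Algebra.trdeg k K →
        (∀ O₁ : ValuationSubring K, O < O₁ → O₁ = ⊤) →
        ((∀ x : K, x ∈ O → ∃ m : ℕ, x ∈ tower O A m) ∨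
          (∃ t : K, t ∈ O ∧ (∀ m : ℕ, t ∉ tower O A m) ∧
            ∀ f : Polynomial k, f ≠ 0 → ¬ O.valuation (Polynomial.aeval t f) < 1)) →
        ¬ SingularPrimeThread O A →
        ∃ m : ℕ, IsRegularLocalRing ↥(tower O A m)) :
    PersistenceRadical → StrictDrop → ∀ p : ℕ, p.Prime → ∀ (k K : Type) [Field k] [CharP k p] [Field K]
      [Algebra k K] (O : ValuationSubring K) (A : Subalgebra k K), (∀ c : k, algebraMap k K c ∈ O) →
      A.FG → IsFractionRing ↥A K → A.toSubring ≤ O.toSubring →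
      (∀ O' : ValuationSubring K,
        (∀ m : ℕ, ∀ s ∈ tower O A m, s ∈ O' ∧ (s⁻¹ ∈ O' → s⁻¹ ∈ O)) → ¬ IsNoetherianRing ↥O') →
      (∀ O' : ValuationSubring K, O < O' → ∃ m : ℕ, ∃ s ∈ tower O A m, s⁻¹ ∈ O' ∧ s⁻¹ ∉ O) →
      (∀ (k' K' : Type) [Field k'] [CharP k' p] [Field K'] [Algebra k' K'] (O' : ValuationSubring K')
        (A' : Subalgebra k' K'), (∀ c : k', algebraMap k' K' c ∈ O') → A'.FG → IsFractionRing ↥A' K' →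
        A'.toSubring ≤ O'.toSubring → Algebra.trdeg k' K' < Algebra.trdeg k K →
        ∃ m : ℕ, IsRegularLocalRing ↥(tower O' A' m)) →
      (∀ m : ℕ, ∀ s ∈ tower O A m, ∃ f : Polynomial k, f ≠ 0 ∧ O.valuation (Polynomial.aeval s f) < 1) →
      3 ≤ Algebra.trdeg k K →
      (∀ O₁ : ValuationSubring K, O < O₁ → O₁ = ⊤) →
      (∀ x : K, x ∈ O → ∃ m : ℕ, x ∈ tower O A m) →
      ¬ SingularPrimeThread O A →
      ∃ m : ℕ, IsRegularLocalRing ↥(tower O A m) := by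
  intro hP hD p hp k K _ _ _ _ O A hk hA hfr hAO hker hmax IH hzd htr hr1 hexh hthr
  exact h hP hD p hp k K O A hk hA hfr hAO hker hmax IH hzd htr hr1 (Or.inl hexh) hthr

/-- **SLOT 2 FROM THE TWO RESIDUALS OF RECORD.**  The registered type of `stub_beta1RankOneSharpF` (v29–v33: `Sig.FactsW →
Coarsening.Sig.stub_beta1RankOneSharp`, with `Sig.FactsW` UNFOLDED to its ten printed theorems) from `Beta1SharpExhaustive` (`h₂`) and
`Beta1SharpCapture` (`h₃`); the facts prefix is not used. [this work] -/
theorem beta1RankOneSharpF_of_capture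
    (h₂ :
      PersistenceRadical → StrictDrop → ∀ p : ℕ, p.Prime → ∀ (k K : Type) [Field k] [CharP k p] [Field K]
        [Algebra k K] (O : ValuationSubring K) (A : Subalgebra k K), (∀ c : k, algebraMap k K c ∈ O) →
        A.FG → IsFractionRing ↥A K → A.toSubring ≤ O.toSubring →
        (∀ O' : ValuationSubring K,
          (∀ m : ℕ, ∀ s ∈ tower O A m, s ∈ O' ∧ (s⁻¹ ∈ O' → s⁻¹ ∈ O)) → ¬ IsNoetherianRing ↥O') →
        (∀ O' : ValuationSubring K, O < O' → ∃ m : ℕ, ∃ s ∈ tower O A m, s⁻¹ ∈ O' ∧ s⁻¹ ∉ O) →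
        (∀ (k' K' : Type) [Field k'] [CharP k' p] [Field K'] [Algebra k' K'] (O' : ValuationSubring K')
          (A' : Subalgebra k' K'), (∀ c : k', algebraMap k' K' c ∈ O') → A'.FG → IsFractionRing ↥A' K' →
          A'.toSubring ≤ O'.toSubring → Algebra.trdeg k' K' < Algebra.trdeg k K →
          ∃ m : ℕ, IsRegularLocalRing ↥(tower O' A' m)) →
        (∀ m : ℕ, ∀ s ∈ tower O A m, ∃ f : Polynomial k, f ≠ 0 ∧ O.valuation (Polynomial.aeval s f) < 1) →
        3 ≤ Algebra.trdeg k K →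
        (∀ O₁ : ValuationSubring K, O < O₁ → O₁ = ⊤) →
        (∀ x : K, x ∈ O → ∃ m : ℕ, x ∈ tower O A m) →
        ¬ SingularPrimeThread O A →
        ∃ m : ℕ, IsRegularLocalRing ↥(tower O A m))
    (h₃ :
      PersistenceRadical → StrictDrop → ∀ p : ℕ, p.Prime → ∀ (k K : Type) [Field k] [CharP k p] [Field K]
        [Algebra k K] (O : ValuationSubring K) (A : Subalgebra k K), (∀ c : k, algebraMap k K c ∈ O) →
        A.FG → IsFractionRing ↥A K → A.toSubring ≤ O.toSubring →
        (∀ O' : ValuationSubring K,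
          (∀ m : ℕ, ∀ s ∈ tower O A m, s ∈ O' ∧ (s⁻¹ ∈ O' → s⁻¹ ∈ O)) → ¬ IsNoetherianRing ↥O') →
        (∀ O' : ValuationSubring K, O < O' → ∃ m : ℕ, ∃ s ∈ tower O A m, s⁻¹ ∈ O' ∧ s⁻¹ ∉ O) →
        (∀ (k' K' : Type) [Field k'] [CharP k' p] [Field K'] [Algebra k' K'] (O' : ValuationSubring K')
          (A' : Subalgebra k' K'), (∀ c : k', algebraMap k' K' c ∈ O') → A'.FG → IsFractionRing ↥A' K' →
          A'.toSubring ≤ O'.toSubring → Algebra.trdeg k' K' < Algebra.trdeg k K →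
          ∃ m : ℕ, IsRegularLocalRing ↥(tower O' A' m)) →
        (∀ m : ℕ, ∀ s ∈ tower O A m, ∃ f : Polynomial k, f ≠ 0 ∧ O.valuation (Polynomial.aeval s f) < 1) →
        3 ≤ Algebra.trdeg k K →
        (∀ O₁ : ValuationSubring K, O < O₁ → O₁ = ⊤) →
        (∃ t : K, t ∈ O ∧ (∀ m : ℕ, t ∉ tower O A m) ∧
          ∀ f : Polynomial k, f ≠ 0 → ¬ O.valuation (Polynomial.aeval t f) < 1) →
        ¬ SingularPrimeThread O A →
        ∃ (N : Subalgebra k K) (m₀ : ℕ), IsNoetherianRing ↥N ∧ N.toSubring ≤ O.toSubring ∧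
          ∀ m : ℕ, m₀ ≤ m → ∀ x ∈ ca (tower O A m), x ∈ N)
    (_hF : (CossartJannsenSaito2020General.{0} ∧ Lipman1969_1_2.{0} ∧ Lipman1969_4_1.{0} ∧ Lipman1969_12_1_i.{0} ∧
        Lipman1969_12_1_ii.{0} ∧ Literature.AlgebraicGeometry.Morphisms.GortzWedhorn2023_24_44_H2.{0}) ∧
      (Lipman1969_16_1_ii.{0} ∧ Lipman1969_16_5.{0} ∧ Lipman1969_27_1_reg_rat.{0} ∧ Lipman1969_27_3_rat.{0})) :
    PersistenceRadical → StrictDrop → ∀ p : ℕ, p.Prime → ∀ (k K : Type) [Field k] [CharP k p] [Field K]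
      [Algebra k K] (O : ValuationSubring K) (A : Subalgebra k K), (∀ c : k, algebraMap k K c ∈ O) →
      A.FG → IsFractionRing ↥A K → A.toSubring ≤ O.toSubring →
      (∀ O' : ValuationSubring K,
        (∀ m : ℕ, ∀ s ∈ tower O A m, s ∈ O' ∧ (s⁻¹ ∈ O' → s⁻¹ ∈ O)) → ¬ IsNoetherianRing ↥O') →
      (∀ O' : ValuationSubring K, O < O' → ∃ m : ℕ, ∃ s ∈ tower O A m, s⁻¹ ∈ O' ∧ s⁻¹ ∉ O) →
      (∀ (k' K' : Type) [Field k'] [CharP k' p] [Field K'] [Algebra k' K'] (O' : ValuationSubring K')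
        (A' : Subalgebra k' K'), (∀ c : k', algebraMap k' K' c ∈ O') → A'.FG → IsFractionRing ↥A' K' →
        A'.toSubring ≤ O'.toSubring → Algebra.trdeg k' K' < Algebra.trdeg k K →
        ∃ m : ℕ, IsRegularLocalRing ↥(tower O' A' m)) →
      (∀ m : ℕ, ∀ s ∈ tower O A m, ∃ f : Polynomial k, f ≠ 0 ∧ O.valuation (Polynomial.aeval s f) < 1) →
      3 ≤ Algebra.trdeg k K →
      (∀ O₁ : ValuationSubring K, O < O₁ → O₁ = ⊤) →
      ((∀ x : K, x ∈ O → ∃ m : ℕ, x ∈ tower O A m) ∨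
        (∃ t : K, t ∈ O ∧ (∀ m : ℕ, t ∉ tower O A m) ∧
          ∀ f : Polynomial k, f ≠ 0 → ¬ O.valuation (Polynomial.aeval t f) < 1)) →
      ¬ SingularPrimeThread O A →
      ∃ m : ℕ, IsRegularLocalRing ↥(tower O A m) :=
  beta1RankOneSharp_of_capture h₂ h₃

end Summit.ResolutionOfSingularities.ResolutionOfSingularities.Theorems.NoZeno.Beta1Capture

end
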